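import Mathlib
import Summits.NavierStokesRegularity.NavierStokesRegularity.Theorems.ThreadingFluxHorizonTowerZonalAssembly
import Summits.NavierStokesRegularity.NavierStokesRegularity.Theorems.ThreadingFluxLoopLawBracketSlotPair
import HarnessLib

/-!
# Crux `PoloidalLiouville` (stmt-NavierStokesRegularity-1222, W1/W2), crux idea «linear-loop-law» (ns-idea-15):
# K-alg ALL DEGREES — `SameDegreeBracketRigidity` of `Cruxes/PoloidalLiouville/LoopLawSketch.lean` (l.107), PROVED FOR EVERY
# DEGREE `l ≥ 1` (body VERBATIM), and `SameDegreeBracketRigidityAt l` for every `l`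

Support file (`--supports stmt-NavierStokesRegularity-1222`, helper).  Experiment cell `ns-wall-extremal`, width hand ns-wall-eng-3 g3
(W1 adjunct; 0 kit).  Statement = the sketch's `SameDegreeBracketRigidity` with `IsSolidHarmonic`, `peval`, `loopBracket` unfolded (the
dress of ns-wall-eng-4 g3's `sameDegreeBracketRigidityAt_one/_two`, p681469/p681472): **two real solid harmonics `A ≠ 0`, `B` of the same
degree `l ≥ 1` whose loop bracket `det(y, ∇A, ∇B)` vanishes identically are proportional.**  The card (V13-P1) carried this for large `l` as
the explicit hypothesis `SameDegreeBracketRigidityAt l` of its priced rungs `PureDegreeShapeRigidityOfBR` / `PureDegreeDatumRungOfBR` and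
proposed a route through transnormal / isoparametric functions on `S²`; the proof here is purely algebraic and uniform in `l`:

1. bracket `≡ 0` ⇒ the polynomial `detP A B = det(∇A, ∇B, x)` is `0` (`loopBracket_evalE`, values determine real polynomials), and
   `lapP A = lapP B = 0`;
2. complexify and pass to the coordinates `(W, V, Z) = (x₀ + i x₁, x₀ − i x₁, x₂)` (eng-5 g4's dictionary `θ`: `lapC_theta`,
   `tripleC_theta`): `P = θA_ℂ`, `Q = θB_ℂ` are `Δ̃`-harmonic of degree `l` with `tripleC P Q = 0`;
3. ★ `Zonal.pair_rigidity` (`ThreadingFluxLoopLawBracketSlotPair.lean`): descent on the top azimuthal weight of `Q` in `span{P, Q}` —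
   equal top weights are subtracted away (harmonic weight slots of fixed degree are one-dimensional), distinct top weights are
   impossible by the SLOT-PAIR IDENTITY (`tripleC` of two non-zero harmonic slots of distinct weights never vanishes: axis-point value
   `l(l+1)(μ−ν)(μ+ν+1)a₀b₀/(2(μ+1)(ν+1))`, mirror, and the mixed-sign coefficient `−2μ|ν|a₀b₀`) ⇒ `Q = c P`;
4. `θ` is injective and the coefficients are real ⇒ `B = (re c) • A`.

Consequence for the card, in its own words: the algebra hypothesis of the priced rungs `…OfBR` is DISCHARGED for every `l` (not only
`l ≤ 2`).  HONEST FRAME: finite-dimensional polynomial algebra about one crux idea's typed objects (information-grade); the rungs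
themselves, `PoloidalLiouville` (1222), `UnthreadedRigidity` (27585) and NS regularity stay OPEN and untouched; W1/W2 movement 0.
-/

-- the summit and its single problem share the name (D-0017 nested layout)
set_option linter.dupNamespace false

noncomputable section

namespace Summit.NavierStokesRegularity.NavierStokesRegularity.Theorems.PoloidalLiouville.LoopLaw

open MvPolynomial
open scoped RealInnerProductSpace
open Literature.Analysis.FluidPDE
open Literature.Geometry.DiscreteGeometry (inner_fin3)
open Summit.NavierStokesRegularity.NavierStokesRegularity.Theorems.PoloidalLiouville.HorizonTower

/-- The loop bracket of two polynomial functions is the polynomial triple product: `⟪y, ∇a(y) × ∇b(y)⟫ = (detP a b)(y)`. [folklore] -/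
theorem loopBracket_evalE (a b : MvPolynomial (Fin 3) ℝ) (y : E3) :
    ⟪y, cross (gradient (Zonal.evalE a) y) (gradient (Zonal.evalE b) y)⟫ = Zonal.evalE (Zonal.detP a b) y := by
  rw [inner_fin3]
  obtain ⟨c0, c1, c2⟩ := cross_fin3 (gradient (Zonal.evalE a) y) (gradient (Zonal.evalE b) y)
  rw [c0, c1, c2]
  simp only [Zonal.gradient_evalE_apply]
  simp [Zonal.detP, Zonal.evalE]

/-- Complex proportionality of real polynomials is real proportionality. [folklore] -/
theorem exists_real_smul_of_map_eq_C_mul {A B : MvPolynomial (Fin 3) ℝ} {c : ℂ} (hA : A ≠ 0)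
    (h : map (algebraMap ℝ ℂ) B = C c * map (algebraMap ℝ ℂ) A) : ∃ r : ℝ, B = r • A := by
  obtain ⟨d₀, hd₀⟩ := exists_coeff_ne_zero hA
  have hcoef : ∀ d, ((coeff d B : ℝ) : ℂ) = c * ((coeff d A : ℝ) : ℂ) := by
    intro d
    have := congrArg (coeff d) h
    rw [coeff_map, coeff_C_mul, coeff_map] at this
    simpa using this
  set r : ℝ := coeff d₀ B / coeff d₀ A with hr
  have hc : c = (r : ℂ) := by
    have h0 := hcoef d₀
    have hA' : ((coeff d₀ A : ℝ) : ℂ) ≠ 0 := by exact_mod_cast hd₀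
    rw [hr, Complex.ofReal_div]
    field_simp
    exact h0.symm
  refine ⟨r, ?_⟩
  ext d
  have h1 := hcoef d
  rw [hc, ← Complex.ofReal_mul] at h1
  rw [coeff_smul, smul_eq_mul]
  exact_mod_cast h1

/-- ★★ **SAME-DEGREE BRACKET RIGIDITY, ALL DEGREES** (body of LoopLawSketch `SameDegreeBracketRigidity`, VERBATIM with `IsSolidHarmonic`,
`peval`, `loopBracket` unfolded): for every `l ≥ 1`, two degree-`l` solid harmonics `A ≠ 0`, `B` on `ℝ³` with `det(y, ∇A(y), ∇B(y)) = 0`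
for all `y` satisfy `B = c • A`. -/
theorem sameDegreeBracketRigidity :
    ∀ (l : ℕ) (A B : MvPolynomial (Fin 3) ℝ), 1 ≤ l →
      (A.IsHomogeneous l ∧ ∀ y : E3, Laplacian.laplacian (fun y : E3 => MvPolynomial.eval (fun i => y i) A) y = 0) →
      (B.IsHomogeneous l ∧ ∀ y : E3, Laplacian.laplacian (fun y : E3 => MvPolynomial.eval (fun i => y i) B) y = 0) →
      A ≠ 0 →
      (∀ y : E3, inner ℝ y (cross (gradient (fun y : E3 => MvPolynomial.eval (fun i => y i) A) y)
        (gradient (fun y : E3 => MvPolynomial.eval (fun i => y i) B) y)) = 0) →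
      ∃ c : ℝ, B = c • A := by
  intro l A B _ hA hB hA0 hbr
  obtain ⟨hAh, hAlap⟩ := hA
  obtain ⟨hBh, hBlap⟩ := hB
  -- 1. the polynomial identities over ℝ
  have eA : (fun y : E3 => MvPolynomial.eval (fun i => y i) A) = Zonal.evalE A := rfl
  have eB : (fun y : E3 => MvPolynomial.eval (fun i => y i) B) = Zonal.evalE B := rfl
  rw [eA] at hAlap hbr
  rw [eB] at hBlap hbr
  have hlapA : Zonal.lapP A = 0 :=
    Zonal.eq_zero_of_evalE_eq_zero fun y => by rw [← Zonal.laplacian_evalE]; exact hAlap y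
  have hlapB : Zonal.lapP B = 0 :=
    Zonal.eq_zero_of_evalE_eq_zero fun y => by rw [← Zonal.laplacian_evalE]; exact hBlap y
  have hdet : Zonal.detP A B = 0 :=
    Zonal.eq_zero_of_evalE_eq_zero fun y => by rw [← loopBracket_evalE]; exact hbr y
  -- 2. complexify and transport to `(W, V, Z)`
  set Ac := map (algebraMap ℝ ℂ) A with hAc
  set Bc := map (algebraMap ℝ ℂ) B with hBc
  set P := Zonal.theta Ac with hP
  set Q := Zonal.theta Bc with hQ
  have hPh : P.IsHomogeneous l := Zonal.isHomogeneous_theta (hAh.map _)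
  have hQh : Q.IsHomogeneous l := Zonal.isHomogeneous_theta (hBh.map _)
  have hPl : Zonal.lapC P = 0 := by rw [hP, Zonal.lapC_theta, hAc, ← Zonal.map_lapP, hlapA, map_zero, map_zero]
  have hQl : Zonal.lapC Q = 0 := by rw [hQ, Zonal.lapC_theta, hBc, ← Zonal.map_lapP, hlapB, map_zero, map_zero]
  have hT : Zonal.tripleC P Q = 0 := by
    rw [hP, hQ, Zonal.tripleC_theta, hAc, hBc, ← Zonal.map_detP, hdet, map_zero, map_zero, mul_zero]
  have hP0 : P ≠ 0 := by
    intro h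
    have h1 : Ac = 0 := Zonal.eq_of_theta_eq _ _ (by rw [← hP, h, map_zero])
    exact hA0 (map_injective _ (algebraMap ℝ ℂ).injective (by rw [← hAc, h1, map_zero]))
  -- 3. pair rigidity in `ℂ[W, V, Z]`
  obtain ⟨c, hc⟩ := Zonal.pair_rigidity hPh hQh hPl hQl hT hP0
  -- 4. back to ℝ
  have hBA : Bc = C c * Ac := Zonal.eq_of_theta_eq _ _ (by rw [← hQ, hc, map_mul, ← hP]; congr 1; exact (Zonal.theta.commutes c).symm ▸ rfl)
  exact exists_real_smul_of_map_eq_C_mul hA0 hBA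

/-- **`SameDegreeBracketRigidityAt l` FOR EVERY `l`** (body of LoopLawSketch `SameDegreeBracketRigidityAt l`, VERBATIM with the defs
unfolded; the sketch's statement has no `1 ≤ l` — the degree-`0` case is two constants): the explicit algebra hypothesis of the card's priced
rungs `PureDegreeShapeRigidityOfBR` / `PureDegreeDatumRungOfBR` holds at every degree. -/
theorem sameDegreeBracketRigidityAt_all (l : ℕ) :
    ∀ (A B : MvPolynomial (Fin 3) ℝ),
      (A.IsHomogeneous l ∧ ∀ y : E3, Laplacian.laplacian (fun y : E3 => MvPolynomial.eval (fun i => y i) A) y = 0) →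
      (B.IsHomogeneous l ∧ ∀ y : E3, Laplacian.laplacian (fun y : E3 => MvPolynomial.eval (fun i => y i) B) y = 0) →
      A ≠ 0 →
      (∀ y : E3, inner ℝ y (cross (gradient (fun y : E3 => MvPolynomial.eval (fun i => y i) A) y)
        (gradient (fun y : E3 => MvPolynomial.eval (fun i => y i) B) y)) = 0) →
      ∃ c : ℝ, B = c • A := by
  intro A B hA hB hA0 hbr
  rcases Nat.eq_zero_or_pos l with rfl | hl
  · -- degree 0: constants
    have hA' : A = C (coeff 0 A) := by
      rw [← totalDegree_eq_zero_iff_eq_C, totalDegree_zero_iff_isHomogeneous]; exact hA.1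
    have hB' : B = C (coeff 0 B) := by
      rw [← totalDegree_eq_zero_iff_eq_C, totalDegree_zero_iff_isHomogeneous]; exact hB.1
    have ha : coeff 0 A ≠ 0 := by
      intro h; apply hA0; rw [hA', h, map_zero]
    refine ⟨coeff 0 B / coeff 0 A, ?_⟩
    rw [hB', hA', smul_eq_C_mul, ← map_mul, coeff_C, coeff_C, if_pos rfl, if_pos rfl, div_mul_cancel₀ _ ha]
  · exact sameDegreeBracketRigidity l A B hl hA hB hA0 hbr

end Summit.NavierStokesRegularity.NavierStokesRegularity.Theorems.PoloidalLiouville.LoopLaw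

end
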